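import Summits.ResolutionOfSingularities.ResolutionOfSingularities.Theorems.HilbertSamuelEliminationCampaignW42ConeDirectrixPrime
import Summits.ResolutionOfSingularities.ResolutionOfSingularities.Theorems.HilbertSamuelEliminationCampaignW42DirectrixTranscendental
import Summits.ResolutionOfSingularities.ResolutionOfSingularities.Theorems.HilbertSamuelEliminationCampaignW42RidgeDimMonotone
import HarnessLib

/-!
# [OURS · L1 W4.2] CJS Thm. 3.10 (4) FOR EVERY COEFFICIENT FIELD, in the local rings: `e(𝒪')_K + d ≤ e(I(c) · K[Y]) + s` at a near
# point of the chart of a permissible blow-up (campaign s42, cell res-hironaka; informal crux `RidgeConfinement`,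
# stmt-ResolutionOfSingularities-17845; `--supports`; brick D4a of the discharge of the named fact `CossartJannsenSaito2020_thm_3_10_4`)

HONEST FRAMING. OURS (slot W4.2, prover res-L1-s42-pv-1, gen 6). [OURS · L1 W4.2] replaces the role of nothing printed in
H. Hironaka's manuscript. This is the local-ring half of the proof that the tree's named fact `CossartJannsenSaito2020_thm_3_10_4`
(CJS LNM 2270 Thm. 3.10 (4) ← Hironaka 1967 Thm. (1,A)) holds for EVERY field `K`: B. Dietel's (8.2.7.B) chain — Nagata's `𝒪'(X)`,
the `s + 1` sections down to the fibre, the cone theorem at the line of `x'` — run for the directrix dimension `e(·)_K` (gen 5 ran it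
for Giraud's ridge, `…CampaignW42RidgeDimMonotone`):

* `exists_ringEquiv_coneLocal_localizedPolynomial_quotient_algebraMap` — the tree's `(A_𝔐)_𝔮 ≅ 𝒪'(X)/𝔫𝒪'(X)` (HIO (31.1)) with its
  action on `𝒪` recorded (it is the `𝒪[𝔭t]/𝔫`-algebra isomorphism);
* `exists_augmentation_localizedPolynomial` — `𝒪'(X) → K(X) = Frac K[X]` over `𝒪' → κ(𝒪') → K`, killing `𝔪'𝒪'(X)`;
* **`exists_dirDimOver_add_le_of_isNearRing`** — `(𝒪, 𝔫, k)` noetherian local universally catenary, `𝔭 = (c)` permissible with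
  `dim 𝒪/𝔭 = s`, `I(c)` without linear forms, `𝒪' = 𝒪[𝔭/c_j]_𝔴` near to `𝒪`, `K` over `κ(𝒪')` and `k` compatibly: there is `d`
  with `H⁽ᵈ⁺¹⁾(𝒪') = H⁽¹⁾(𝒪)` and `e(𝒪')_K + d ≤ e(I(c) · K[Y]) + s`. The field is carried through `K(X)` (over the residue field
  `κ(x')(X)` of `𝒪'(X)`) and brought back by `e(I(c) · K(X)[Y]) = e(I(c) · K[Y])` (`…CampaignW42DirectrixTranscendental`); the cone
  step is `…CampaignW42ConeDirectrixPrime`; the sections are `…CampaignW42DirectrixSections`.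

NOTHING here is a statement of H. Hironaka's manuscript [Hironaka2017]. AI review is weaker than expert review. References
(orientation only): V. Cossart, U. Jannsen, S. Saito, LNM 2270 (2020), Thm. 3.10 (4), proof p. 46–50; H. Hironaka, J. Math.
Kyoto Univ. 7 (1967), Thm. (1,A); B. Dietel, Dissertation Regensburg (2015), Satz (8.2.7) p. 105; M. Herrmann, S. Ikeda, U. Orbanz,
*Equimultiplicity and Blowing up* (1988), Thm. (31.1).
-/

noncomputable section

-- single-conjunct summit: the doubled namespace component `ResolutionOfSingularities` is mandated
set_option linter.dupNamespace false
-- localizations of polynomial rings over quotient rings: nested instance problems (as in the gen-3/4/5 files)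
set_option maxSynthPendingDepth 3

open CategoryTheory AlgebraicGeometry TopologicalSpace IsLocalRing MvPolynomial Module
open Literature.AlgebraicGeometry.Resolution Literature.AlgebraicGeometry.Resolution.HironakaScheme
open Literature.RingTheory.HilbertSamuel Literature.RingTheory.MvPolynomial
open Literature.AlgebraicGeometry.CossartJannsenSaito2020
open Summit.ResolutionOfSingularities.ResolutionOfSingularities.Theorems.SigmaMaxModificationsCorridor3.Directrix214Sharp

namespace Summit.ResolutionOfSingularities.ResolutionOfSingularities.Theorems

namespace CampaignW42

universe u

/-! ## `(A_𝔐)_𝔮 ≅ 𝒪'(X)/𝔫𝒪'(X)` over `𝒪` -/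

section ConeLocal

/-- **`((R₀/E)_𝔐)_p ≅ T/ET` compatibly with `R₀`** (the tree's `nonempty_ringEquiv_localization_localization_quotient` with its
action on `R₀` recorded): both sides are the localization of `R₀/E` at `Q/E`, and the isomorphism is the `R₀/E`-algebra one.
[folklore] -/
theorem exists_ringEquiv_localization_localization_quotient_algebraMap {R₀ : Type u} [CommRing R₀] {E Q : Ideal R₀}
    [Q.IsPrime] (hEQ : E ≤ Q) (T : Type u) [CommRing T] [Algebra R₀ T] [IsLocalization.AtPrime T Q] (𝔐 : Ideal (R₀ ⧸ E))
    [𝔐.IsPrime] (hQ𝔐 : Q.map (Ideal.Quotient.mk E) ≤ 𝔐) :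
    haveI := isPrime_map_quotientMk_of_le hEQ
    haveI := isPrime_map_localization_atPrime_of_le 𝔐 hQ𝔐
    ∃ e : Localization.AtPrime ((Q.map (Ideal.Quotient.mk E)).map (algebraMap (R₀ ⧸ E) (Localization.AtPrime 𝔐))) ≃+*
        T ⧸ E.map (algebraMap R₀ T),
      ∀ x : R₀, e (algebraMap (R₀ ⧸ E) _ (Ideal.Quotient.mk E x)) = Ideal.Quotient.mk _ (algebraMap R₀ T x) := by
  haveI := isPrime_map_quotientMk_of_le hEQ
  haveI := isPrime_map_localization_atPrime_of_le 𝔐 hQ𝔐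
  haveI h1 := isLocalization_atPrime_localization_map_of_le 𝔐 hQ𝔐
  haveI h2 := isLocalization_atPrime_quotient_mapExt_of_le hEQ T
  refine ⟨(IsLocalization.algEquiv (Q.map (Ideal.Quotient.mk E)).primeCompl
    (Localization.AtPrime ((Q.map (Ideal.Quotient.mk E)).map (algebraMap (R₀ ⧸ E) (Localization.AtPrime 𝔐))))
    (T ⧸ E.map (algebraMap R₀ T))).toRingEquiv, fun x => ?_⟩
  change (IsLocalization.algEquiv (Q.map (Ideal.Quotient.mk E)).primeCompl
    (Localization.AtPrime ((Q.map (Ideal.Quotient.mk E)).map (algebraMap (R₀ ⧸ E) (Localization.AtPrime 𝔐))))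
    (T ⧸ E.map (algebraMap R₀ T))) (algebraMap (R₀ ⧸ E) _ (Ideal.Quotient.mk E x)) = _
  rw [AlgEquiv.commutes]
  rfl

variable {O : Type u} [CommRing O] [IsLocalRing O] {𝔭 : Ideal O} (a : O) (ha : a ∈ 𝔭)
  (P : Ideal (HomogeneousLocalization.Away (reesGrading 𝔭) (reesT a ha))) [P.IsPrime]
  (O' : Type u) [CommRing O'] [Algebra (HomogeneousLocalization.Away (reesGrading 𝔭) (reesT a ha)) O']
  [IsLocalization.AtPrime O' P] [IsLocalRing O'] [Algebra O O']

/-- **`(A_𝔐)_𝔮 ≅ 𝒪'(X)/𝔫𝒪'(X)` compatibly with `𝒪`**: the tree's isomorphism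
`nonempty_ringEquiv_coneLocal_localizedPolynomial_quotient` (HIO (31.1) (2)–(3), CJS (3.14)), re-derived together with its
value on the image of `𝒪` (`r ↦ r` on both sides). [cite: CossartJannsenSaito2020, Thm. 3.10 (proof, (3.14), p. 46)]
[cite: HerrmannIkedaOrbanz1988, Thm. (31.1) (proof, (2)–(3))] -/
theorem exists_ringEquiv_coneLocal_localizedPolynomial_quotient_algebraMap
    (hP : P.comap (reesChartBase a ha) = maximalIdeal O)
    (hOO' : ∀ r : O, algebraMap O O' r =
      (algebraMap (HomogeneousLocalization.Away (reesGrading 𝔭) (reesT a ha)) O' : _ →+* O') (reesChartBase a ha r)) :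
    haveI := isPrime_coneLocalPrime a ha P hP
    ∃ e : Localization.AtPrime (coneLocalPrime a ha P) ≃+*
        LocalizedPolynomial O' ⧸ (maximalIdeal O).map (algebraMap O (LocalizedPolynomial O')),
      ∀ r : O, e (algebraMap (FibreCone 𝔭) (Localization.AtPrime (coneLocalPrime a ha P))
        (Ideal.Quotient.mk (reesMaxExt 𝔭) (algebraMap O (ReesRing 𝔭) r))) =
        Ideal.Quotient.mk _ (algebraMap O (LocalizedPolynomial O') r) := by
  haveI := isPrime_coneLocalPrime a ha P hP
  letI := reesRingLocalizedPolynomialAlgebra a ha P O'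
  haveI := isLocalization_atPrime_localizedPolynomial_chartPrime a ha P O'
  have hQ𝔐 : (chartPrime a ha P).map (Ideal.Quotient.mk (reesMaxExt 𝔭)) ≤ fibreConeVertex 𝔭 :=
    conePrime_le_fibreConeVertex a ha P hP
  obtain ⟨e, he⟩ := exists_ringEquiv_localization_localization_quotient_algebraMap (reesMaxExt_le_chartPrime a ha P hP)
    (LocalizedPolynomial O') (fibreConeVertex 𝔭) hQ𝔐
  have hmq := map_reesMaxExt_localizedPolynomial a ha P O' hOO'
  refine ⟨e.trans (Ideal.quotEquivOfEq hmq), fun r => ?_⟩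
  have h1 : e (algebraMap (FibreCone 𝔭) (Localization.AtPrime (coneLocalPrime a ha P))
      (Ideal.Quotient.mk (reesMaxExt 𝔭) (algebraMap O (ReesRing 𝔭) r))) =
      Ideal.Quotient.mk _ (algebraMap (ReesRing 𝔭) (LocalizedPolynomial O') (algebraMap O (ReesRing 𝔭) r)) :=
    he (algebraMap O (ReesRing 𝔭) r)
  have h2 : (e.trans (Ideal.quotEquivOfEq hmq)) (algebraMap (FibreCone 𝔭) (Localization.AtPrime (coneLocalPrime a ha P))
      (Ideal.Quotient.mk (reesMaxExt 𝔭) (algebraMap O (ReesRing 𝔭) r))) =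
      Ideal.quotEquivOfEq hmq (e (algebraMap (FibreCone 𝔭) (Localization.AtPrime (coneLocalPrime a ha P))
        (Ideal.Quotient.mk (reesMaxExt 𝔭) (algebraMap O (ReesRing 𝔭) r)))) := rfl
  refine h2.trans ?_
  rw [h1, Ideal.quotEquivOfEq_mk, algebraMap_reesRing_localizedPolynomial_algebraMap a ha P O' hOO' r]

end ConeLocal

/-! ## The augmentation `𝒪'(X) → K(X)` -/

/-- **An augmentation `𝒪'(X) = 𝒪'[X]_{𝔪'[X]} → K(X) = Frac K[X]`** over a field `K ⊇ κ(𝒪')`: coefficients through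
`𝒪' → κ(𝒪') → K`, `X ↦ X`; it kills the maximal ideal `𝔪' 𝒪'(X)`. [cite: CossartJannsenSaito2020, Lemma 2.27 (proof of Thm. 3.10, p. 47)] -/
theorem exists_augmentation_localizedPolynomial (O' : Type u) [CommRing O'] [IsLocalRing O'] (K : Type u) [Field K]
    [Algebra (ResidueField O') K] :
    ∃ σ : LocalizedPolynomial O' →+* FractionRing (Polynomial K),
      (∀ p : Polynomial O', σ (algebraMap (Polynomial O') (LocalizedPolynomial O') p) =
        algebraMap (Polynomial K) (FractionRing (Polynomial K))
          (Polynomial.map ((algebraMap (ResidueField O') K).comp (residue O')) p)) ∧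
      ∀ x ∈ maximalIdeal (LocalizedPolynomial O'), σ x = 0 := by
  set f : O' →+* K := (algebraMap (ResidueField O') K).comp (residue O') with hf
  let g : Polynomial O' →+* FractionRing (Polynomial K) :=
    (algebraMap (Polynomial K) (FractionRing (Polynomial K))).comp (Polynomial.mapRingHom f)
  have hker : RingHom.ker g = (maximalIdeal O').map (Polynomial.C : O' →+* Polynomial O') := by
    ext p
    rw [RingHom.mem_ker, Ideal.mem_map_C_iff]
    change algebraMap (Polynomial K) (FractionRing (Polynomial K)) (Polynomial.map f p) = 0 ↔ _
    rw [map_eq_zero_iff _ (IsFractionRing.injective (Polynomial K) (FractionRing (Polynomial K))), Polynomial.ext_iff]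
    refine forall_congr' fun i => ?_
    rw [Polynomial.coeff_map, Polynomial.coeff_zero, hf, RingHom.comp_apply, map_eq_zero_iff _ (RingHom.injective _),
      residue_eq_zero_iff]
  obtain ⟨σ, hσ, hσ0⟩ := exists_ringHom_of_ker_eq g _ hker (LocalizedPolynomial O')
  exact ⟨σ, fun p => by rw [← RingHom.comp_apply, hσ]; rfl, hσ0⟩

/-! ## Local rings: the chart of a permissible blow-up at a near point, for `e(·)_K` -/

section Chart

variable {O : Type u} [CommRing O] [IsLocalRing O] [IsNoetherianRing O] {n : ℕ} (c : Fin n → O) (j : Fin n)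

local notation3 "𝔭" => Ideal.span (Set.range c)
local notation3 "hcj" => Ideal.mem_span_range_self (f := c) (x := j)

variable (P : Ideal (chartRing c j)) [P.IsPrime]
variable (O' : Type u) [CommRing O'] [Algebra (chartRing c j) O'] [IsLocalization.AtPrime O' P]
  [IsLocalRing O'] [IsNoetherianRing O'] [Algebra O O']

-- (`maxHeartbeats`: six local rings presented as localizations / quotients of polynomial rings over local rings; instance
-- unification along the chain is slow)
set_option maxHeartbeats 800000 in
/-- **CJS Thm. 3.10 (4) in the local rings, EVERY field — `e(𝒪')_K + d ≤ e(I(c) · K[Y]) + s`.** `𝒪` noetherian local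
universally catenary, `𝔭 = (c_1, …, c_n)` permissible with `dim 𝒪/𝔭 = s` whose fibre-cone ideal `I(c) ⊆ k[Y]` has no linear
forms, `𝒪' = 𝒪[𝔭/c_j]_𝔴` (`𝔴` over `𝔫`) near to `𝒪` at level `N`, `K` a field over `κ(𝒪')` and over `k = κ(𝒪)` compatibly.
Then there is `d` (`= dim R/𝔮 − 1`, the residual transcendence degree) with `H⁽ᵈ⁺¹⁾(𝒪') = H⁽¹⁾(𝒪)` and
`e(𝒪')_K + d ≤ e(I(c) · K[Y]) + s`. [cite: CossartJannsenSaito2020, Thm. 3.10 (4), proof p. 46–50]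
[cite: Dietel2015, Satz (8.2.7) (ii) p. 105] -/
theorem exists_dirDimOver_add_le_of_isNearRing (hO : IsUniversallyCatenaryRing O) [(𝔭).IsPrime]
    [IsRegularLocalRing (O ⧸ 𝔭)] {s : ℕ} (hs : ringKrullDim (O ⧸ 𝔭) = s) (hNF : (𝔭).IsNormallyFlat)
    (hP : P.comap (chartBase c j) = maximalIdeal O)
    (hOO' : ∀ r : O, algebraMap O O' r = (algebraMap (chartRing c j) O' : chartRing c j →+* O') (chartBase c j r))
    {N : ℕ} (hnear : IsNearRing O O' N) (hI1 : finrank (ResidueField O) (idealDegree (fibreConeIdeal c) 1) = 0)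
    (K : Type u) [Field K] [Algebra (ResidueField O') K] [Algebra (ResidueField O) K]
    (hK : ∀ r : O, algebraMap (ResidueField O') K (residue O' (algebraMap O O' r)) =
      algebraMap (ResidueField O) K (residue O r)) :
    ∃ d : ℕ, hilbertSamuelFun O' (d + 1) = hilbertSamuelFun O 1 ∧
      dirDimOver O' K + d ≤ directrixDim ((fibreConeIdeal c).map (MvPolynomial.map (algebraMap (ResidueField O) K))) + s := by
  classical
  haveI h𝔮 := isPrime_coneLocalPrime (c j) hcj P hP
  haveI h𝔓 := isPrime_chartConePrime c j P hP
  haveI := isNoetherianRing_chart c j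
  obtain ⟨d, hd⟩ := exists_ringKrullDim_quotient_eq_nat (FibreConeLocal (𝔭)) (coneLocalPrime (c j) hcj P)
  obtain ⟨h1d, hBen, hVert, hOO⟩ := near_chain_equalities c j P O' hO hs hNF hP hOO' hnear hd
  -- the auxiliary field `K(X)` and the augmentation `σ : 𝒪'(X) → K(X)`
  set KX := FractionRing (Polynomial K) with hKXdef
  set ι : ResidueField O' →+* K := algebraMap (ResidueField O') K with hι
  obtain ⟨σ, hσ, hσ0⟩ := exists_augmentation_localizedPolynomial O' K
  haveI hσloc : IsLocalHom σ := isLocalHom_of_forall_mem_maximalIdeal σ hσ0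
  have hσO' : ∀ a : O', σ (algebraMap O' (LocalizedPolynomial O') a) = algebraMap K KX (ι (residue O' a)) := fun a => by
    rw [IsScalarTower.algebraMap_apply O' (Polynomial O') (LocalizedPolynomial O'), Polynomial.algebraMap_apply, hσ,
      Polynomial.map_C, IsScalarTower.algebraMap_apply K (Polynomial K) KX, Polynomial.algebraMap_apply]
    rfl
  -- the quotient `Q = 𝒪'(X)/𝔫𝒪'(X)` and its augmentation
  haveI hlocq := isLocalRing_localizedPolynomial_quotient (c j) hcj P O' hP hOO'
  have hle𝔪 := map_maximalIdeal_localizedPolynomial_le (c j) hcj P O' hP hOO'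
  let σQ : (LocalizedPolynomial O' ⧸ (maximalIdeal O).map (algebraMap O (LocalizedPolynomial O'))) →+* KX :=
    Ideal.Quotient.lift _ σ (fun x hx => hσ0 x (hle𝔪 hx))
  have hσQ0 : ∀ x ∈ maximalIdeal (LocalizedPolynomial O' ⧸ (maximalIdeal O).map (algebraMap O (LocalizedPolynomial O'))),
      σQ x = 0 := fun x hx => by
    have hmQ : (maximalIdeal (LocalizedPolynomial O')).map (algebraMap (LocalizedPolynomial O')
        (LocalizedPolynomial O' ⧸ (maximalIdeal O).map (algebraMap O (LocalizedPolynomial O')))) =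
        maximalIdeal (LocalizedPolynomial O' ⧸ (maximalIdeal O).map (algebraMap O (LocalizedPolynomial O'))) :=
      Literature.RingTheory.HilbertSamuel.map_maximalIdeal_eq_of_surjective
        (by rw [Ideal.Quotient.algebraMap_eq]; exact Ideal.Quotient.mk_surjective)
    rw [← hmQ, Ideal.Quotient.algebraMap_eq] at hx
    obtain ⟨y, hy, rfl⟩ := (Ideal.mem_map_iff_of_surjective _ Ideal.Quotient.mk_surjective).mp hx
    change Ideal.Quotient.lift _ σ _ (Ideal.Quotient.mk _ y) = 0
    rw [Ideal.Quotient.lift_mk]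
    exact hσ0 y hy
  haveI hσQloc : IsLocalHom σQ := isLocalHom_of_forall_mem_maximalIdeal σQ hσQ0
  -- the isomorphism `R_𝔮 ≅ Q`, over `𝒪`
  obtain ⟨e, he⟩ := exists_ringEquiv_coneLocal_localizedPolynomial_quotient_algebraMap (c j) hcj P O' hP hOO'
  -- the field `K(X)` over the residue fields of `𝒪'`, `𝒪'(X)`, `Q`, `R_𝔮`
  letI algO' : Algebra (ResidueField O') KX := ((algebraMap K KX).comp ι).toAlgebra
  letI algN : Algebra (ResidueField (LocalizedPolynomial O')) KX := (ResidueField.lift σ).toAlgebra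
  letI algQ : Algebra (ResidueField (LocalizedPolynomial O' ⧸ (maximalIdeal O).map (algebraMap O (LocalizedPolynomial O')))) KX :=
    (ResidueField.lift σQ).toAlgebra
  letI algR : Algebra (ResidueField (Localization.AtPrime (coneLocalPrime (c j) hcj P))) KX :=
    ((algebraMap (ResidueField (LocalizedPolynomial O' ⧸ (maximalIdeal O).map (algebraMap O (LocalizedPolynomial O')))) KX).comp
      (ResidueField.map (e : Localization.AtPrime (coneLocalPrime (c j) hcj P) →+*
        LocalizedPolynomial O' ⧸ (maximalIdeal O).map (algebraMap O (LocalizedPolynomial O'))))).toAlgebra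
  -- (A) the cone theorem for the directrix at the line `𝔮` of the fibre cone
  have hI𝔓 := fibreConeIdeal_le_chartConePrime c j P
  haveI := isPrime_map_quotientMk_of_le hI𝔓
  have hdS : ringKrullDim (MvPolynomial (Fin n) (ResidueField O) ⧸ chartConePrime c j P) = d :=
    (ringKrullDim_quotient_chartConePrime_eq c j P hP).trans hd
  have hH : hilbertFunQuot (ResidueField O) n (fibreConeIdeal c) =
      hilbertSamuelFun (Localization.AtPrime (coneLocalPrime (c j) hcj P)) d := by
    rw [hBen, hilbertSamuelFun_zero, hilbertFun_fibreConeLocal_eq_hilbertFunQuot c]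
  letI algTR := algebraOfFibreCone c (Localization.AtPrime (coneLocalPrime (c j) hcj P))
  haveI := isLocalization_atPrime_coneLocalPrime c j P hP
  have hA := dirDimOver_add_le_directrixDim_of_hilbertFunQuot_le_hilbertSamuelFun (isHomogeneousIdeal_fibreConeIdeal c) hI1
    hI𝔓 hdS rfl (Localization.AtPrime (coneLocalPrime (c j) hcj P)) hH.le KX
  -- the coefficient map of (A) is `k → K → K(X)`
  have hcoef : (algebraMap (ResidueField (Localization.AtPrime (coneLocalPrime (c j) hcj P))) KX).comp
      ((residue (Localization.AtPrime (coneLocalPrime (c j) hcj P))).comp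
        ((algebraMap (MvPolynomial (Fin n) (ResidueField O) ⧸ fibreConeIdeal c) (Localization.AtPrime (coneLocalPrime (c j) hcj P))).comp
          ((Ideal.Quotient.mk (fibreConeIdeal c)).comp (C : ResidueField O →+* MvPolynomial (Fin n) (ResidueField O))))) =
      (algebraMap K KX).comp (algebraMap (ResidueField O) K) := by
    refine RingHom.ext fun x => ?_
    obtain ⟨r, rfl⟩ := residue_surjective x
    simp only [RingHom.comp_apply]
    -- the element `r` read in `R_𝔮`
    have h1 : algebraMap (MvPolynomial (Fin n) (ResidueField O) ⧸ fibreConeIdeal c) (Localization.AtPrime (coneLocalPrime (c j) hcj P))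
        (Ideal.Quotient.mk (fibreConeIdeal c) (C (residue O r))) =
        algebraMap (FibreCone (𝔭)) (Localization.AtPrime (coneLocalPrime (c j) hcj P))
          (Ideal.Quotient.mk (reesMaxExt (𝔭)) (algebraMap O (ReesRing (𝔭)) r)) := by
      change ((algebraMap (FibreCone (𝔭)) (Localization.AtPrime (coneLocalPrime (c j) hcj P))).comp
        (fibreConeQuotEquiv c).toRingHom) (Ideal.Quotient.mk (fibreConeIdeal c) (C (residue O r))) = _
      rw [RingHom.comp_apply]
      congr 1
      change fibreConeQuotEquiv c (Ideal.Quotient.mk (fibreConeIdeal c) (C (residue O r))) = _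
      rw [fibreConeQuotEquiv_mk, fibreConePolyMap, eval₂Hom_C, fibreConeResidueMap_residue]
    rw [h1]
    -- through `e`, `σ_Q`, `σ`
    change (algebraMap (ResidueField (LocalizedPolynomial O' ⧸ (maximalIdeal O).map (algebraMap O (LocalizedPolynomial O')))) KX)
      (ResidueField.map (e : Localization.AtPrime (coneLocalPrime (c j) hcj P) →+*
        LocalizedPolynomial O' ⧸ (maximalIdeal O).map (algebraMap O (LocalizedPolynomial O'))) (residue _ _)) = _
    rw [ResidueField.map_residue]
    change ResidueField.lift σQ (residue _ (e _)) = _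
    rw [ResidueField.lift_residue_apply, he r]
    change Ideal.Quotient.lift _ σ _ (Ideal.Quotient.mk _ (algebraMap O (LocalizedPolynomial O') r)) = _
    rw [Ideal.Quotient.lift_mk, IsScalarTower.algebraMap_apply O (Polynomial O') (LocalizedPolynomial O'), Polynomial.algebraMap_apply,
      hσ, Polynomial.map_C, RingHom.comp_apply, hK r, IsScalarTower.algebraMap_apply K (Polynomial K) KX, Polynomial.algebraMap_apply]
    rfl
  rw [hcoef] at hA
  -- descent `K(X) → K`
  have hdesc : directrixDim ((fibreConeIdeal c).map (MvPolynomial.map ((algebraMap K KX).comp (algebraMap (ResidueField O) K)))) =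
      directrixDim ((fibreConeIdeal c).map (MvPolynomial.map (algebraMap (ResidueField O) K))) := by
    have hmm : (fibreConeIdeal c).map (MvPolynomial.map ((algebraMap K KX).comp (algebraMap (ResidueField O) K))) =
        ((fibreConeIdeal c).map (MvPolynomial.map (algebraMap (ResidueField O) K))).map (MvPolynomial.map (algebraMap K KX)) := by
      rw [Ideal.map_map]
      congr 1
      exact (RingHom.ext fun p => (MvPolynomial.map_map _ _ p)).symm
    rw [hmm]
    exact directrixDim_map_fractionRingPolynomial_eq K _ (isHomogeneousIdeal_map _ (isHomogeneousIdeal_fibreConeIdeal c))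
  rw [hdesc] at hA
  -- (B) Nagata's `𝒪'(X)` and its `s + 1` hypersurface sections down to `R_𝔮`
  obtain ⟨x, hx⟩ := exists_maximalIdeal_eq_sup_span_range (𝔭) hs
  have hchain : hilbertSamuelFun (Localization.AtPrime (coneLocalPrime (c j) hcj P)) ((d - 1) + (s + 1)) =
      hilbertSamuelFun O' ((d - 1) + 0) := by
    have h1 := hilbertSamuelFun_add_eq_of_eq hBen s
    rw [add_zero] at h1 ⊢
    rw [show d - 1 + (s + 1) = s + d by omega, h1, hVert, ← hOO]
  have hHq : hilbertSamuelFun (Localization.AtPrime (coneLocalPrime (c j) hcj P)) (s + 1) = hilbertFun O' := by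
    have h := hilbertSamuelFun_eq_of_add_eq hchain
    rw [hilbertSamuelFun_zero] at h
    exact h
  have hHN : hilbertSamuelFun (LocalizedPolynomial O' ⧸ (maximalIdeal O).map (algebraMap O (LocalizedPolynomial O')))
      (s + 1) = hilbertFun (LocalizedPolynomial O') := by
    rw [hilbertSamuelFun_localizedPolynomial_quotient_eq (c j) hcj P O' hP hOO' (s + 1), hHq, hilbertFun_localizedPolynomial]
  let t : Fin (s + 1) → LocalizedPolynomial O' :=
    Fin.cons (algebraMap O (LocalizedPolynomial O') (c j)) fun k => algebraMap O (LocalizedPolynomial O') (x k)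
  have hKer : (maximalIdeal O).map (algebraMap O (LocalizedPolynomial O')) = Ideal.span (Set.range t) := by
    refine le_antisymm ?_ ?_
    · rw [hx, Ideal.map_sup, map_span_range_localizedPolynomial_eq c j O' hOO', Ideal.map_span]
      refine sup_le ?_ ?_
      · rw [Ideal.span_singleton_le_iff_mem]
        exact Ideal.subset_span ⟨0, by simp only [t, Fin.cons_zero]⟩
      · rw [Ideal.span_le]
        rintro _ ⟨_, ⟨k, rfl⟩, rfl⟩
        exact Ideal.subset_span ⟨k.succ, by simp only [t, Fin.cons_succ]⟩
    · rw [Ideal.span_le]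
      rintro _ ⟨k, rfl⟩
      refine Fin.cases ?_ (fun k => ?_) k
      · simp only [t, Fin.cons_zero]
        refine Ideal.mem_map_of_mem _ ?_
        rw [hx]
        exact Ideal.mem_sup_left hcj
      · simp only [t, Fin.cons_succ]
        refine Ideal.mem_map_of_mem _ ?_
        rw [hx]
        exact Ideal.mem_sup_right (Ideal.subset_span ⟨k, rfl⟩)
  have hB : dirDimOver (LocalizedPolynomial O') KX ≤
      dirDimOver (LocalizedPolynomial O' ⧸ (maximalIdeal O).map (algebraMap O (LocalizedPolynomial O'))) KX + (s + 1) := by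
    refine dirDimOver_le_dirDimOver_add_of_hilbertSamuelFun_eq ?_ t ?_ hHN KX fun y => ?_
    · rw [Ideal.Quotient.algebraMap_eq]; exact Ideal.Quotient.mk_surjective
    · rw [Ideal.Quotient.algebraMap_eq, Ideal.mk_ker, hKer]
    · rw [Ideal.Quotient.algebraMap_eq]
      change ResidueField.lift σQ (residue _ (Ideal.Quotient.mk _ y)) = ResidueField.lift σ (residue _ y)
      rw [ResidueField.lift_residue_apply, ResidueField.lift_residue_apply, Ideal.Quotient.lift_mk]
  -- (C) `e(Q)_{K(X)} = e(R_𝔮)_{K(X)}`, `e(𝒪'(X))_{K(X)} = e(𝒪')_{K(X)} ≥ e(𝒪')_K`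
  have hRq : dirDimOver (LocalizedPolynomial O' ⧸ (maximalIdeal O).map (algebraMap O (LocalizedPolynomial O'))) KX =
      dirDimOver (Localization.AtPrime (coneLocalPrime (c j) hcj P)) KX :=
    dirDimOver_eq_of_ringEquiv e KX rfl
  have hRN : dirDimOver (LocalizedPolynomial O') KX = dirDimOver O' KX := by
    have hm := map_maximalIdeal_localizedPolynomial O'
    haveI := isLocalHom_of_map_maximalIdeal_eq hm
    refine dirDimOver_eq_of_flat_of_map_maximalIdeal_eq hm KX ?_
    refine RingHom.ext fun z => ?_
    obtain ⟨a, rfl⟩ := residue_surjective z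
    rw [RingHom.comp_apply, ResidueField.map_residue]
    change ResidueField.lift σ (residue _ (algebraMap O' (LocalizedPolynomial O') a)) = algebraMap K KX (ι (residue O' a))
    rw [ResidueField.lift_residue_apply, hσO']
  have hmono : dirDimOver O' K ≤ dirDimOver O' KX := by
    have h1 : dirDimOver O' KX = directrixDim (((canonicalTangentConeIdeal O').map (MvPolynomial.map ι)).map
        (MvPolynomial.map (algebraMap K KX))) := by
      unfold dirDimOver
      rw [Ideal.map_map]
      congr 2
      exact (RingHom.ext fun p => (MvPolynomial.map_map _ _ p)).symm
    rw [h1]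
    exact directrixDim_le_directrixDim_map (algebraMap K KX) _
  -- assemble
  refine ⟨d - 1, ?_, ?_⟩
  · have h := hilbertSamuelFun_add_eq_of_eq hOO 1
    rw [add_zero, show 1 + (d - 1) = d - 1 + 1 by omega] at h
    exact h
  · rw [hRN, hRq] at hB
    omega

end Chart

end CampaignW42

end Summit.ResolutionOfSingularities.ResolutionOfSingularities.Theorems

end
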